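import Summits.ResolutionOfSingularities.ResolutionOfSingularities.Theorems.MarkedTransferCampaignW46ThreefoldsGammaFreeGlobalMeasureFibre
import HarnessLib

/-!
# [OURS · L1 W4.6 rung (ii), dimension ladder] THE TERMINATION MEASURE: comparison of the global sums before and after blowing up
# a point at which all branches are regular (brick B10b-sums of rung (ii-2) `GammaFreeGlobalOrderReductionDimLE p 2`)

Cell res-hironaka, LADDER-RESOLUTION rung L (D-0089), slot W4.6, rung (ii) (dimension ladder, res-L1-type-o1 p496755); seat
res-D-pv-049 AS res-L1-s46-pv-11 (holder of rung (ii-2); architecture v2, STATUS 2026-08-27T05:4xZ). Host route MarkedTransfer,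
host item `HypersurfaceOrderReductionDimLeThree` (stmt-ResolutionOfSingularities-16156); proposed `--kind proof --supports` it
`--as helper`. Everything here is OURS bookkeeping; nothing of H. Hironaka's manuscript [Hironaka2017] is asserted. AI-written;
AI review is weaker than expert review.

## What is proved (setting of brick B10b-fibre: lifted branches `j_k : C_k ↪ X′`, new family `ζ′ : ι ⊕ σ → X′`)

* `familyDelta_lt_of_inl_le` — the `Δ`-component drops strictly when one member's `Σδ` drops and none goes up (case (A), fed by
  brick B10b-fam); `familyDelta_sum_eq` — it is unchanged when the members are the same curves (cases (B), (C), brick B10b-reg).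
* `familyTangency_le`, `familyTangency_add_one_le` — `Σ(i−1)` does not go up, and drops when two branches through `x` are
  tangent (case (B)).
* `familyExcess_add_one_le` — `Σ(k−2)⁺` drops when the branches through `x` are pairwise transversal and at least three
  (case (C)).

## Sources

* R. Hartshorne, *Algebraic Geometry* (1977), Ch. V Thm. 3.9 (embedded resolution of curves in surfaces). [Hartshorne1977]
* J. Kollár, *Lectures on Resolution of Singularities* (2007), §1.4, Thm. 1.47. [Kollar2007]
* H. Hironaka, ms. 2017-03-23, Def. 2.1 p.5 — scope only, under adjudication, not cited as fact. [Hironaka2017]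
-/

noncomputable section

set_option linter.dupNamespace false -- mandated namespace of this single-conjunct summit

open CategoryTheory AlgebraicGeometry TopologicalSpace IsLocalRing Topology

namespace Summit.ResolutionOfSingularities.ResolutionOfSingularities.Theorems

namespace CampaignW46

open Literature.AlgebraicGeometry.Resolution
open Scheme.IdealSheafData

universe u

/-! ## §1 The `Δ`-component -/

section Delta

variable {ι σ : Type} [Finite ι] [Finite σ]

/-- The total `δ`-invariant of an integral Noetherian quasi-excellent curve is finite. [cite: Kollar2007, §1.4] -/
theorem finsum_pointDelta_ne_top {C : Scheme.{u}} [IsIntegral C] [IsNoetherian C] (hC : Scheme.IsQuasiExcellent C)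
    (hdim : topologicalKrullDim C ≤ 1) : ∑ᶠ c, pointDelta C c ≠ ⊤ := by
  rw [finsum_eq_sum _ (finite_support_pointDelta hC hdim)]
  exact ENat.sum_ne_top.mpr fun c _ => pointDelta_ne_top hC hdim c

/-- **Case (A): `Δ` drops.** If member-wise `Σδ(C′_{inl k}) ≤ Σδ(C_k)` with one strict inequality, all `Σδ(C_k)` finite, and the
new members `inr s` have `Σδ = 0`, then `Δ(C′) < Δ(C)`. [cite: Kollar2007, §1.4] -/
theorem familyDelta_lt_of_inl_le (C : ι → Scheme.{u}) [∀ k, IsIntegral (C k)] (C' : ι ⊕ σ → Scheme.{u})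
    [∀ k', IsIntegral (C' k')] (hfin : ∀ k, ∑ᶠ c, pointDelta (C k) c ≠ ⊤)
    (hle : ∀ k, ∑ᶠ c, pointDelta (C' (Sum.inl k)) c ≤ ∑ᶠ c, pointDelta (C k) c)
    (hlt : ∃ k, ∑ᶠ c, pointDelta (C' (Sum.inl k)) c < ∑ᶠ c, pointDelta (C k) c)
    (hE : ∀ s, ∑ᶠ c, pointDelta (C' (Sum.inr s)) c = 0) : familyDelta C' < familyDelta C := by
  classical
  haveI := Fintype.ofFinite ι
  obtain ⟨k₀, hk₀⟩ := hlt
  rw [familyDelta_def, familyDelta_def, finsum_sum_type, finsum_eq_zero_of_forall_eq_zero hE, add_zero,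
    finsum_eq_sum_of_fintype, finsum_eq_sum_of_fintype, ← Finset.add_sum_erase _ _ (Finset.mem_univ k₀),
    ← Finset.add_sum_erase _ _ (Finset.mem_univ k₀)]
  have hrest : ∑ k ∈ Finset.univ.erase k₀, ∑ᶠ c, pointDelta (C' (Sum.inl k)) c ≤
      ∑ k ∈ Finset.univ.erase k₀, ∑ᶠ c, pointDelta (C k) c := Finset.sum_le_sum fun k _ => hle k
  have hrest_ne : ∑ k ∈ Finset.univ.erase k₀, ∑ᶠ c, pointDelta (C k) c ≠ ⊤ :=
    ENat.sum_ne_top.mpr fun k _ => hfin k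
  calc ∑ᶠ c, pointDelta (C' (Sum.inl k₀)) c + ∑ k ∈ Finset.univ.erase k₀, ∑ᶠ c, pointDelta (C' (Sum.inl k)) c
      ≤ ∑ᶠ c, pointDelta (C' (Sum.inl k₀)) c + ∑ k ∈ Finset.univ.erase k₀, ∑ᶠ c, pointDelta (C k) c :=
        add_le_add_right hrest _
    _ < ∑ᶠ c, pointDelta (C k₀) c + ∑ k ∈ Finset.univ.erase k₀, ∑ᶠ c, pointDelta (C k) c :=
        WithTop.add_lt_add_right hrest_ne hk₀

/-- **Cases (B), (C): `Δ` is unchanged** when the old members are the same curves and the new members have `Σδ = 0`.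
[cite: Kollar2007, §1.4] -/
theorem familyDelta_sum_eq (C : ι → Scheme.{u}) [∀ k, IsIntegral (C k)] (C' : ι ⊕ σ → Scheme.{u})
    [∀ k', IsIntegral (C' k')] (hinl : ∀ k, ∑ᶠ c, pointDelta (C' (Sum.inl k)) c = ∑ᶠ c, pointDelta (C k) c)
    (hE : ∀ s, ∑ᶠ c, pointDelta (C' (Sum.inr s)) c = 0) : familyDelta C' = familyDelta C := by
  rw [familyDelta_def, familyDelta_def, finsum_sum_type, finsum_eq_zero_of_forall_eq_zero hE, add_zero]
  exact finsum_congr hinl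

end Delta

/-! ## §2 The components `Σ(i−1)` and `Σ(k−2)⁺` after blowing up a point at which all branches are regular -/

section Sums

variable {X X' : Scheme.{u}} [IsIntegral X] [IsNoetherian X] (hX : Scheme.IsRegular X) (hXq : Scheme.IsQuasiExcellent X)
  (hdim : topologicalKrullDim X ≤ 2)
  {x : X} (hx : IsClosed ({x} : Set X)) (hxne : ({x} : Set X) ≠ Set.univ) (hR2 : ringKrullDim (X.presheaf.stalk x) = 2)
  {π : X' ⟶ X} (hπ : IsBlowup π (vanishingIdeal ⟨{x}, hx⟩)) [IsIntegral X'] [IsNoetherian X']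
  (hXq' : Scheme.IsQuasiExcellent X') (hdim' : topologicalKrullDim X' ≤ 2)
  {ι σ : Type} [Finite ι] [Finite σ] [Subsingleton σ]
  (ζ : ι → X) (hζinj : Function.Injective ζ) (hcoh : ∀ k, Order.coheight (ζ k) = 1) (hζx : ∀ k, ζ k ≠ x)
  (C : ι → Scheme.{u}) [∀ k, IsIntegral (C k)] (j : ∀ k, C k ⟶ X') [∀ k, IsClosedImmersion (j k)]
  [∀ k, IsClosedImmersion (j k ≫ π)] (hjζ : ∀ k, π (j k (genericPoint (C k))) = ζ k)
  {η : X'} (hη : IsGenericPoint η (π ⁻¹' ({x} : Set X)))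
  (ζ' : ι ⊕ σ → X') (hζ'inj : Function.Injective ζ') (hcoh' : ∀ k', Order.coheight (ζ' k') = 1)
  (hinl : ∀ k, ζ' (Sum.inl k) = j k (genericPoint (C k))) (hinr : ∀ s, ζ' (Sum.inr s) = η)

include hX hπ hjζ hη hinl hinr in
omit [IsIntegral X] [IsIntegral X'] [AlgebraicGeometry.IsNoetherian X'] in
/-- The second component counts pairs of OLD branches only: pairs with the exceptional branch contribute nothing.
[cite: Hartshorne1977, Ch. V Prop. 3.6] -/
theorem familyTangency_eq_finsum_inl :
    familyTangency ζ' = ∑ᶠ (k : ι) (l : ι) (_ : k ≠ l), pairTangency ζ' (Sum.inl k) (Sum.inl l) := by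
  classical
  have h0 : ∀ k s, pairTangency ζ' (Sum.inl k) (Sum.inr s) = 0 ∧ pairTangency ζ' (Sum.inr s) (Sum.inl k) = 0 := fun k s =>
    ⟨finsum_eq_zero_of_forall_eq_zero fun y' => (pairTangencyAt_inl_inr_eq_zero hX hx hπ ζ C j hjζ hη ζ' hinl hinr k s y').1,
      finsum_eq_zero_of_forall_eq_zero fun y' => (pairTangencyAt_inl_inr_eq_zero hX hx hπ ζ C j hjζ hη ζ' hinl hinr k s y').2⟩
  rw [familyTangency_def, finsum_sum_type]
  have h2 : ∑ᶠ (s : σ) (l' : ι ⊕ σ) (_ : Sum.inr s ≠ l'), pairTangency ζ' (Sum.inr s) l' = 0 := by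
    refine finsum_eq_zero_of_forall_eq_zero fun s => finsum_eq_zero_of_forall_eq_zero fun l' => ?_
    rcases l' with l | t
    · rw [(h0 l s).2, finsum_eq_if, ite_self]
    · rw [finsum_eq_if, if_neg (fun hne : Sum.inr s ≠ Sum.inr t => hne (congrArg Sum.inr (Subsingleton.elim s t)))]
  rw [h2, add_zero]
  refine finsum_congr fun k => ?_
  rw [finsum_sum_type]
  have h3 : ∑ᶠ (t : σ) (_ : Sum.inl k ≠ Sum.inr t), pairTangency ζ' (Sum.inl k) (Sum.inr t) = 0 :=
    finsum_eq_zero_of_forall_eq_zero fun t => by rw [(h0 k t).1, finsum_eq_if, ite_self]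
  rw [h3, add_zero]
  refine finsum_congr fun l => finsum_congr_Prop (by rw [Ne, Sum.inl.injEq]) fun _ => rfl

include hX hXq hdim hxne hR2 hπ hXq' hdim' hζinj hcoh hζx hjζ hζ'inj hcoh' hinl in
omit [Subsingleton σ] in
/-- **Per pair of old branches: the total tangency does not go up, and drops if the pair is tangent at `x`.**
[cite: Hartshorne1977, Ch. V Cor. 3.7] -/
theorem pairTangency_inl_le {k l : ι} (hkl : k ≠ l) :
    pairTangency ζ' (Sum.inl k) (Sum.inl l) ≤ pairTangency ζ k l ∧
    (ζ k ⤳ x → ζ l ⤳ x → stalkIdeal (primeDivisorIdeal (ζ k)) x ⊔ stalkIdeal (primeDivisorIdeal (ζ l)) x ≠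
        maximalIdeal (X.presheaf.stalk x) → pairTangency ζ' (Sum.inl k) (Sum.inl l) + 1 ≤ pairTangency ζ k l) := by
  have hπinl : ∀ k, π (ζ' (Sum.inl k)) = ζ k := fun k => by rw [hinl, hjζ]
  have hfin' := finite_support_pairTangencyAt hXq' hdim' ζ' hζ'inj hcoh' (k := Sum.inl k) (l := Sum.inl l)
    (fun e => hkl (Sum.inl_injective e))
  have hfin := finite_support_pairTangencyAt hXq hdim ζ hζinj hcoh hkl
  rw [pairTangency_def, pairTangency_def,
    finsum_eq_finsum_mem_preimage_add hx hπ hfin' fun y' hy' => pairTangencyAt_inl_inl_of_apply_ne hx hπ ζ ζ' hπinl hy' k l,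
    finsum_eq_add_finsum_mem_compl hfin x]
  obtain ⟨h1, h2⟩ := finsum_mem_preimage_pairTangencyAt_le hX hx hxne hR2 hπ ζ hζinj hcoh hζx C j hjζ ζ' hinl hkl
  refine ⟨add_le_add_left h1 _, fun hk hl htan => ?_⟩
  have := h2 hk hl htan
  omega

include hX hXq hdim hxne hR2 hπ hXq' hdim' hζinj hcoh hζx hjζ hη hζ'inj hcoh' hinl hinr in
/-- **`Σ(i−1)` does not go up; it drops if two branches through `x` are tangent.** [cite: Hartshorne1977, Ch. V Thm. 3.9] -/
theorem familyTangency_le :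
    familyTangency ζ' ≤ familyTangency ζ ∧
    ((∃ k l, k ≠ l ∧ ζ k ⤳ x ∧ ζ l ⤳ x ∧ stalkIdeal (primeDivisorIdeal (ζ k)) x ⊔ stalkIdeal (primeDivisorIdeal (ζ l)) x ≠
        maximalIdeal (X.presheaf.stalk x)) → familyTangency ζ' + 1 ≤ familyTangency ζ) := by
  classical
  haveI := Fintype.ofFinite ι
  rw [familyTangency_eq_finsum_inl hX hx hπ ζ C j hjζ hη ζ' hinl hinr, familyTangency_def]
  simp only [finsum_eq_sum_of_fintype, finsum_eq_if]
  have hpair := fun k l (hkl : k ≠ l) =>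
    pairTangency_inl_le hX hXq hdim hx hxne hR2 hπ hXq' hdim' ζ hζinj hcoh hζx C j hjζ ζ' hζ'inj hcoh' hinl hkl
  constructor
  · refine Finset.sum_le_sum fun k _ => Finset.sum_le_sum fun l _ => ?_
    split_ifs with hkl
    · exact (hpair k l hkl).1
    · exact le_rfl
  · rintro ⟨k₀, l₀, hne, hk, hl, htan⟩
    have hind : ∀ k l, (if k ≠ l then pairTangency ζ' (Sum.inl k) (Sum.inl l) else 0) +
        (if k = k₀ ∧ l = l₀ then 1 else 0) ≤ (if k ≠ l then pairTangency ζ k l else 0) := by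
      intro k l
      by_cases hkl : k ≠ l
      · rw [if_pos hkl, if_pos hkl]
        by_cases h0 : k = k₀ ∧ l = l₀
        · rw [if_pos h0]; obtain ⟨rfl, rfl⟩ := h0; exact (hpair k l hkl).2 hk hl htan
        · rw [if_neg h0, add_zero]; exact (hpair k l hkl).1
      · have h0 : ¬ (k = k₀ ∧ l = l₀) := fun h => hkl (by rw [h.1, h.2]; exact hne)
        rw [if_neg hkl, if_neg hkl, if_neg h0]
    have hone : (1 : ℕ) ≤ ∑ k, ∑ l, (if k = k₀ ∧ l = l₀ then 1 else 0 : ℕ) := by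
      calc (1 : ℕ) = (if k₀ = k₀ ∧ l₀ = l₀ then 1 else 0 : ℕ) := by simp
        _ ≤ ∑ l, (if k₀ = k₀ ∧ l = l₀ then 1 else 0 : ℕ) :=
            Finset.single_le_sum (f := fun l => (if k₀ = k₀ ∧ l = l₀ then 1 else 0 : ℕ)) (fun _ _ => Nat.zero_le _)
              (Finset.mem_univ l₀)
        _ ≤ ∑ k, ∑ l, (if k = k₀ ∧ l = l₀ then 1 else 0 : ℕ) :=
            Finset.single_le_sum (f := fun k => ∑ l, (if k = k₀ ∧ l = l₀ then 1 else 0 : ℕ)) (fun _ _ => Nat.zero_le _)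
              (Finset.mem_univ k₀)
    calc (∑ k, ∑ l, if k ≠ l then pairTangency ζ' (Sum.inl k) (Sum.inl l) else 0) + 1
        ≤ (∑ k, ∑ l, if k ≠ l then pairTangency ζ' (Sum.inl k) (Sum.inl l) else 0) +
            ∑ k, ∑ l, (if k = k₀ ∧ l = l₀ then 1 else 0 : ℕ) := add_le_add_right hone _
      _ = ∑ k, ∑ l, ((if k ≠ l then pairTangency ζ' (Sum.inl k) (Sum.inl l) else 0) +
            (if k = k₀ ∧ l = l₀ then 1 else 0 : ℕ)) := by
          rw [← Finset.sum_add_distrib]; exact Finset.sum_congr rfl fun k _ => (Finset.sum_add_distrib).symm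
      _ ≤ ∑ k, ∑ l, (if k ≠ l then pairTangency ζ k l else 0) :=
          Finset.sum_le_sum fun k _ => Finset.sum_le_sum fun l _ => hind k l

include hX hXq hdim hxne hR2 hπ hXq' hdim' hζinj hcoh hζx hjζ hη hζ'inj hcoh' hinl hinr in
/-- **`Σ(k−2)⁺` drops when the branches through `x` are pairwise transversal and at least three.**
[cite: Hartshorne1977, Ch. V Thm. 3.9] -/
theorem familyExcess_add_one_le
    (htr : ∀ k l, k ≠ l → ζ k ⤳ x → ζ l ⤳ x →
      stalkIdeal (primeDivisorIdeal (ζ k)) x ⊔ stalkIdeal (primeDivisorIdeal (ζ l)) x = maximalIdeal (X.presheaf.stalk x))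
    (h3 : 3 ≤ branchCount ζ x) : familyExcess ζ' + 1 ≤ familyExcess ζ := by
  have hπinl : ∀ k, π (ζ' (Sum.inl k)) = ζ k := fun k => by rw [hinl, hjζ]
  have hπinr : ∀ s, π (ζ' (Sum.inr s)) = x := fun s => by rw [hinr]; exact apply_excGen_eq hη
  have hfin' := finite_support_branchCount_sub_two hXq' hdim' ζ' hζ'inj hcoh'
  have hfin := finite_support_branchCount_sub_two hXq hdim ζ hζinj hcoh
  rw [familyExcess_def, familyExcess_def,
    finsum_eq_finsum_mem_preimage_add hx hπ (f := fun y => branchCount ζ y - 2) hfin' fun y' hy' => by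
      rw [branchCount_eq_of_apply_ne hx hπ ζ ζ' hπinl hπinr hy'],
    finsum_eq_add_finsum_mem_compl hfin x]
  have h0 : ∑ᶠ y' ∈ π ⁻¹' ({x} : Set X), (branchCount ζ' y' - 2) = 0 :=
    finsum_mem_of_eqOn_zero fun y' hy' => by
      have := branchCount_le_two_of_transversal hX hx hxne hR2 hπ ζ hζinj hcoh hζx C j hjζ ζ' hinl htr hy'
      change branchCount ζ' y' - 2 = 0
      omega
  rw [h0, zero_add]
  omega

end Sums

end CampaignW46

end Summit.ResolutionOfSingularities.ResolutionOfSingularities.Theorems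

end
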